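import Summits.MatrixMultiplication.MatrixMultiplication.Theorems.SoloInformedCwTwoBoundary
import Literature.Computability.AlgebraicComplexity.KoszulYoungCertificate
import Mathlib.LinearAlgebra.Matrix.Kronecker
import Mathlib.LinearAlgebra.Matrix.Charpoly.Coeff
import HarnessLib

/-!
# The Cayley skew form `Ω_T` on `K²⁷`: a rank obstruction to degeneration of `3 × 3 × 3` tensors

Solo programme `solo-MatrixMultiplication-informed`, generation 26 (tool file; the census of NO
instances `P ⋭ N_k`, `cw₂ ⋭ N_k` is `SoloInformedCwTwoCayleyCensus.lean`).

* `CayleyOmega.cayleyForm T` — for `T ∈ K³ ⊗ K³ ⊗ K³` the skew form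
  `Ω_T(u, w) = Σ T_{xyz} ε(x,u₁,w₁) ε(y,u₂,w₂) ε(z,u₃,w₃)` on `K²⁷` (the `SL₃³`-equivariant map
  `V → Λ² V`, `V = K³⊗K³⊗K³`), a `27 × 27` matrix `Σ_v T_v · E_{v₁} ⊗ₖ E_{v₂} ⊗ₖ E_{v₃}`,
  `(E_x)_{pq} = ε_{xpq}` (`cayleyForm_eq_sum`).
* **Equivariance** (`conj_cayleyForm_tsubst3`): `G · Ω_{(A,B,C)·T} · Gᵀ = det A det B det C · Ω_T`,
  `G = A ⊗ₖ B ⊗ₖ C`, from the `3 × 3` identity `A (Σ_a A_{xa} E_a) Aᵀ = det A · E_x`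
  (`conj_cayleyEA`); so invertible substitutions do not increase `rank Ω` (`rank_cayleyForm_tsubst3_le`).
* **Semicontinuity under degeneration** (`rank_cayleyForm_le_of_polyDegeneratesTo`): if an integer
  tensor `S` degenerates to `N` (`PolyDegeneratesTo`, Alman 2021 §2.4) then
  `rank Ω_N ≤ sup_L rank Ω_{S ⊗ L}`.  The substitution `(A(ε),B(ε),C(ε))` of a degeneration need not
  be invertible; it is replaced by `A(ε) + ε^M·1, …` for ONE exponent `M > h` making the three
  determinants non-zero (`exists_pert_det_ne_zero`: the product of the three characteristic
  polynomials has `≤ 9` roots in `K[ε]`, so one of `ε^{h+1}, …, ε^{h+10}` is not a root), which moves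
  the substituted tensor only in orders `≥ M` (`polySubst_pert`); the rank inequality over `K(ε)` is
  the tree's `rank_le_rank_map_of_perturbation`.

Sources: `Ω_T` is the classical `SL₃(K)³`-covariant of degree one of the `3 × 3 × 3` format
(we use only the elementary identity above, [folklore]); degenerations [cite: Alman2021, §2.4];
the tensors `P`, `cw₂` [cite: ConnerGesmundoLandsbergVentura2022, §3.2].  Everything is PROVED;
the imports `SoloInformedCwTwoBoundary` (for `sThree`, `nurmiev`) and `KoszulYoungCertificate`
(for `rank_le_rank_map_of_perturbation`, `finCode`, `intTriCheckUnit`) are tree files.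
-/

namespace Summit.MatrixMultiplication.MatrixMultiplication.Theorems

open Matrix Polynomial Finset
open Literature.Computability.AlgebraicComplexity Literature.Barriers.MatrixMultiplication
open Literature.LinearAlgebra.Matrix
open scoped Kronecker Polynomial

universe u

namespace CayleyOmega

/-- The index set `{0,1,2}³` of the basis of `K³ ⊗ K³ ⊗ K³`. [folklore] -/
abbrev Idx : Type := Fin 3 × Fin 3 × Fin 3

section Form

variable {R : Type*} [CommRing R]

/-- The slice `E_x` of the Levi-Civita tensor: `(E_x)_{pq} = ε_{xpq}`. [folklore] -/
def cayleyE (R : Type*) [CommRing R] (x : Fin 3) : Matrix (Fin 3) (Fin 3) R :=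
  fun p q => (leviCivita3Table x p q : R)

/-- **The Cayley form** `Ω_N(p, q) = Σ_v N_v ε(v₁,p₁,q₁) ε(v₂,p₂,q₂) ε(v₃,p₃,q₃)` (`27 × 27`).
[folklore] -/
def cayleyForm (N : Fin 3 → Fin 3 → Fin 3 → R) : Matrix Idx Idx R :=
  fun p q => ∑ v : Idx, N v.1 v.2.1 v.2.2 *
    ((leviCivita3Table v.1 p.1 q.1 : R) * (leviCivita3Table v.2.1 p.2.1 q.2.1 : R) *
      (leviCivita3Table v.2.2 p.2.2 q.2.2 : R))

/-- `Ω_N = Σ_v N_v · E_{v₁} ⊗ E_{v₂} ⊗ E_{v₃}`. [folklore] -/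
theorem cayleyForm_eq_sum (N : Fin 3 → Fin 3 → Fin 3 → R) :
    cayleyForm N = ∑ v : Idx, N v.1 v.2.1 v.2.2 •
      (cayleyE R v.1 ⊗ₖ (cayleyE R v.2.1 ⊗ₖ cayleyE R v.2.2)) := by
  ext p q
  simp only [cayleyForm, Matrix.sum_apply, Matrix.smul_apply, Matrix.kroneckerMap_apply, cayleyE,
    smul_eq_mul, mul_assoc]

/-- `Ω` is additive in the tensor. [folklore] -/
theorem cayleyForm_add (N N' : Fin 3 → Fin 3 → Fin 3 → R) :
    cayleyForm (N + N') = cayleyForm N + cayleyForm N' := by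
  ext p q
  simp only [cayleyForm, Pi.add_apply, Matrix.add_apply, add_mul, Finset.sum_add_distrib]

/-- `Ω` is homogeneous in the tensor. [folklore] -/
theorem cayleyForm_smul (c : R) (N : Fin 3 → Fin 3 → Fin 3 → R) :
    cayleyForm (c • N) = c • cayleyForm N := by
  ext p q
  simp only [cayleyForm, Pi.smul_apply, smul_eq_mul, Matrix.smul_apply, Finset.mul_sum, mul_assoc]

/-- `Ω` commutes with ring homomorphisms. [folklore] -/
theorem cayleyForm_map {S : Type*} [CommRing S] (f : R →+* S) (N : Fin 3 → Fin 3 → Fin 3 → R) :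
    (cayleyForm N).map f = cayleyForm (fun a b c => f (N a b c)) := by
  ext p q
  simp only [cayleyForm, Matrix.map_apply, map_sum, map_mul, map_intCast]

/-- `Ω` of an integer tensor read in `R` is the integer `Ω` cast to `R`. [folklore] -/
theorem cayleyForm_intCast (N : Fin 3 → Fin 3 → Fin 3 → ℤ) (p q : Idx) :
    cayleyForm (fun a b c => (N a b c : R)) p q = ((cayleyForm N p q : ℤ) : R) := by
  simp only [cayleyForm, Int.cast_sum, Int.cast_mul, Int.cast_id]

/-- Matrix form of `cayleyForm_intCast`. [folklore] -/
theorem cayleyForm_map_intCast (N : Fin 3 → Fin 3 → Fin 3 → ℤ) :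
    (cayleyForm N).map (Int.cast : ℤ → R) = cayleyForm (fun a b c => (N a b c : R)) := by
  ext p q
  rw [Matrix.map_apply, cayleyForm_intCast]

/-! ## Substitution and equivariance -/

/-- The substituted tensor `((A,B,C)·T)_{abc} = Σ_{xyz} T_{xyz} A_{xa} B_{yb} C_{zc}` (the tree's
`polySubst` with the sum over `{0,1,2}³` bundled). [cite: Alman2021, §2.4] -/
def tsubst3 (T : Fin 3 → Fin 3 → Fin 3 → R) (A B C : Fin 3 → Fin 3 → R) :
    Fin 3 → Fin 3 → Fin 3 → R :=
  fun a b c => ∑ v : Idx, T v.1 v.2.1 v.2.2 * (A v.1 a * B v.2.1 b * C v.2.2 c)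

/-- `polySubst` is `tsubst3` of the constant tensor. [cite: Alman2021, §2.4] -/
theorem polySubst_eq_tsubst3 {K : Type*} [CommRing K] (t : Fin 3 → Fin 3 → Fin 3 → K)
    (A B C : Fin 3 → Fin 3 → K[X]) :
    polySubst t A B C = tsubst3 (fun a b c => Polynomial.C (t a b c)) A B C := by
  funext a b c
  simp only [polySubst, tsubst3, Fintype.sum_prod_type]

/-- The substituted Levi-Civita slice `Σ_a A_{xa} E_a`. [folklore] -/
def cayleyEA (A : Fin 3 → Fin 3 → R) (x : Fin 3) : Matrix (Fin 3) (Fin 3) R :=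
  ∑ a, A x a • cayleyE R a

/-- Entries of `cayleyEA`. [folklore] -/
theorem cayleyEA_apply (A : Fin 3 → Fin 3 → R) (x p q : Fin 3) :
    cayleyEA A x p q = ∑ a, A x a * (leviCivita3Table a p q : R) := by
  simp only [cayleyEA, Matrix.sum_apply, Matrix.smul_apply, cayleyE, smul_eq_mul]

/-- **The `3 × 3` identity** `A · (Σ_a A_{xa} E_a) · Aᵀ = det A · E_x`
(`Σ_{apq} A_{xa} A_{sp} A_{tq} ε_{apq} = det A · ε_{xst}`), checked by `ring`. [folklore] -/
theorem conj_cayleyEA (A : Fin 3 → Fin 3 → R) (x : Fin 3) :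
    Matrix.of A * cayleyEA A x * (Matrix.of A)ᵀ = (Matrix.of A).det • cayleyE R x := by
  ext s t
  simp only [Matrix.mul_apply, Matrix.transpose_apply, Matrix.smul_apply, Matrix.of_apply,
    cayleyEA_apply, cayleyE, smul_eq_mul, Matrix.det_fin_three, Fin.sum_univ_three]
  fin_cases x <;> fin_cases s <;> fin_cases t <;> simp [leviCivita3Table] <;> ring

/-- A product of three sums over `Fin 3` is one sum over `{0,1,2}³`. [folklore] -/
theorem sum_mul_sum_mul_sum (f g h : Fin 3 → R) :
    (∑ a, f a) * ((∑ b, g b) * (∑ c, h c)) = ∑ u : Idx, f u.1 * (g u.2.1 * h u.2.2) := by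
  rw [Finset.sum_mul_sum, Finset.sum_mul_sum]
  simp only [Finset.mul_sum, Fintype.sum_prod_type]

/-- `Ω_{(A,B,C)·T} = Σ_v T_v · (EA_{v₁} ⊗ EB_{v₂} ⊗ EC_{v₃})`. [folklore] -/
theorem cayleyForm_tsubst3 (T : Fin 3 → Fin 3 → Fin 3 → R) (A B C : Fin 3 → Fin 3 → R) :
    cayleyForm (tsubst3 T A B C) = ∑ v : Idx, T v.1 v.2.1 v.2.2 •
      (cayleyEA A v.1 ⊗ₖ (cayleyEA B v.2.1 ⊗ₖ cayleyEA C v.2.2)) := by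
  ext p q
  simp only [cayleyForm, tsubst3, Matrix.sum_apply, Matrix.smul_apply, Matrix.kroneckerMap_apply,
    cayleyEA_apply, smul_eq_mul]
  simp only [sum_mul_sum_mul_sum]
  simp only [Finset.sum_mul, Finset.mul_sum]
  rw [Finset.sum_comm]
  refine Finset.sum_congr rfl fun v _ => Finset.sum_congr rfl fun u _ => ?_
  ring

/-- **Equivariance of `Ω`**: `G · Ω_{(A,B,C)·T} · Gᵀ = det A det B det C · Ω_T`, `G = A ⊗ B ⊗ C`.
[folklore] -/
theorem conj_cayleyForm_tsubst3 (T : Fin 3 → Fin 3 → Fin 3 → R) (A B C : Fin 3 → Fin 3 → R) :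
    (Matrix.of A ⊗ₖ (Matrix.of B ⊗ₖ Matrix.of C)) * cayleyForm (tsubst3 T A B C) *
        (Matrix.of A ⊗ₖ (Matrix.of B ⊗ₖ Matrix.of C))ᵀ =
      ((Matrix.of A).det * (Matrix.of B).det * (Matrix.of C).det) • cayleyForm T := by
  have hT : (Matrix.of A ⊗ₖ (Matrix.of B ⊗ₖ Matrix.of C))ᵀ =
      (Matrix.of A)ᵀ ⊗ₖ ((Matrix.of B)ᵀ ⊗ₖ (Matrix.of C)ᵀ) := by
    rw [← Matrix.kroneckerMap_transpose, ← Matrix.kroneckerMap_transpose]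
  rw [cayleyForm_tsubst3, cayleyForm_eq_sum, Finset.mul_sum, Finset.sum_mul, Finset.smul_sum]
  refine Finset.sum_congr rfl fun v _ => ?_
  rw [Matrix.mul_smul, ← Matrix.mul_kronecker_mul, ← Matrix.mul_kronecker_mul, Matrix.smul_mul, hT,
    ← Matrix.mul_kronecker_mul, ← Matrix.mul_kronecker_mul, conj_cayleyEA, conj_cayleyEA,
    conj_cayleyEA]
  simp only [Matrix.smul_kronecker, Matrix.kronecker_smul, smul_smul]
  congr 1
  ring

end Form

/-! ## Rank monotonicity -/

section Rank

variable {F : Type*} [Field F]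

/-- Invertible substitutions do not increase `rank Ω`. [folklore] -/
theorem rank_cayleyForm_tsubst3_le (T : Fin 3 → Fin 3 → Fin 3 → F) (A B C : Fin 3 → Fin 3 → F)
    (hA : (Matrix.of A).det ≠ 0) (hB : (Matrix.of B).det ≠ 0) (hC : (Matrix.of C).det ≠ 0) :
    (cayleyForm (tsubst3 T A B C)).rank ≤ (cayleyForm T).rank := by
  set G : Matrix Idx Idx F := Matrix.of A ⊗ₖ (Matrix.of B ⊗ₖ Matrix.of C) with hG
  have hdet : IsUnit G.det := by
    rw [hG, Matrix.det_kronecker, Matrix.det_kronecker]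
    exact isUnit_iff_ne_zero.2 (mul_ne_zero (pow_ne_zero _ hA)
      (pow_ne_zero _ (mul_ne_zero (pow_ne_zero _ hB) (pow_ne_zero _ hC))))
  have hdetT : IsUnit Gᵀ.det := by rwa [Matrix.det_transpose]
  have h1 : (G * cayleyForm (tsubst3 T A B C) * Gᵀ).rank = (cayleyForm (tsubst3 T A B C)).rank := by
    rw [Matrix.rank_mul_eq_left_of_isUnit_det Gᵀ _ hdetT,
      Matrix.rank_mul_eq_right_of_isUnit_det G _ hdet]
  rw [← h1, hG, conj_cayleyForm_tsubst3]
  set d := (Matrix.of A).det * (Matrix.of B).det * (Matrix.of C).det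
  calc (d • cayleyForm T).rank = ((d • (1 : Matrix Idx Idx F)) * cayleyForm T).rank := by
        rw [Matrix.smul_mul, Matrix.one_mul]
    _ ≤ (cayleyForm T).rank := Matrix.rank_mul_le_right _ _

end Rank

/-! ## Degenerations: perturbing the substitution to an invertible one -/

section Degeneration

variable {K : Type u} [Field K]

/-- `A + y · 1` on substitution maps. [folklore] -/
noncomputable def pert (y : K[X]) (A : Fin 3 → Fin 3 → K[X]) : Fin 3 → Fin 3 → K[X] :=
  fun x a => A x a + if x = a then y else 0

/-- The perturbed substitution changes the substituted tensor by a multiple of `y`. [folklore] -/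
theorem polySubst_pert (t : Fin 3 → Fin 3 → Fin 3 → K) (A B C : Fin 3 → Fin 3 → K[X]) (y : K[X])
    (a b c : Fin 3) :
    ∃ q, polySubst t (pert y A) (pert y B) (pert y C) a b c = polySubst t A B C a b c + y * q := by
  refine ⟨∑ x, ∑ x', ∑ x'', Polynomial.C (t x x' x'') *
    ((if x = a then 1 else 0) * pert y B x' b * pert y C x'' c +
      A x a * (if x' = b then 1 else 0) * pert y C x'' c +
      A x a * B x' b * (if x'' = c then 1 else 0)), ?_⟩
  simp only [polySubst, pert, Finset.mul_sum, ← Finset.sum_add_distrib]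
  refine Finset.sum_congr rfl fun x _ => Finset.sum_congr rfl fun x' _ =>
    Finset.sum_congr rfl fun x'' _ => ?_
  split_ifs <;> ring

/-- `det (A + y·1)` is the characteristic polynomial of `-A` evaluated at `y`. [folklore] -/
theorem det_pert (A : Fin 3 → Fin 3 → K[X]) (y : K[X]) :
    (Matrix.of (pert y A)).det = (-Matrix.of A).charpoly.eval y := by
  rw [Matrix.charpoly, ← Polynomial.coe_evalRingHom, RingHom.map_det]
  congr 1
  ext i j : 1
  simp only [RingHom.mapMatrix_apply, Matrix.map_apply, Polynomial.coe_evalRingHom,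
    Matrix.charmatrix_apply, Matrix.diagonal_apply, Matrix.neg_apply, Matrix.of_apply, pert]
  split_ifs <;> simp [add_comm]

/-- **One exponent works for all three matrices**: among `y = X^{m}, …, X^{m+9}` there is one with
`det (A + y·1), det (B + y·1), det (C + y·1)` all non-zero (the product of the three characteristic
polynomials is monic of degree `9`, so it has at most `9` roots in the domain `K[X]`). [folklore] -/
theorem exists_pert_det_ne_zero (A B C : Fin 3 → Fin 3 → K[X]) (m : ℕ) :
    ∃ i < 10, (Matrix.of (pert (X ^ (m + i)) A)).det ≠ 0 ∧
      (Matrix.of (pert (X ^ (m + i)) B)).det ≠ 0 ∧ (Matrix.of (pert (X ^ (m + i)) C)).det ≠ 0 := by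
  classical
  set Q : K[X][X] := (-Matrix.of A).charpoly * (-Matrix.of B).charpoly * (-Matrix.of C).charpoly
    with hQ
  have hQm : Q.Monic :=
    ((Matrix.charpoly_monic _).mul (Matrix.charpoly_monic _)).mul (Matrix.charpoly_monic _)
  have hQdeg : Q.natDegree = 9 := by
    rw [hQ, ((Matrix.charpoly_monic _).mul (Matrix.charpoly_monic _)).natDegree_mul
      (Matrix.charpoly_monic _), (Matrix.charpoly_monic _).natDegree_mul (Matrix.charpoly_monic _)]
    simp only [Matrix.charpoly_natDegree_eq_dim, Fintype.card_fin]
  suffices h : ∃ i < 10, ¬ Q.IsRoot (X ^ (m + i)) by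
    obtain ⟨i, hi, hroot⟩ := h
    refine ⟨i, hi, ?_⟩
    rw [Polynomial.IsRoot.def, hQ, Polynomial.eval_mul, Polynomial.eval_mul] at hroot
    rw [det_pert, det_pert, det_pert]
    exact ⟨fun h0 => hroot (mul_eq_zero_of_left (mul_eq_zero_of_left h0 _) _),
      fun h0 => hroot (mul_eq_zero_of_left (mul_eq_zero_of_right _ h0) _),
      fun h0 => hroot (mul_eq_zero_of_right _ h0)⟩
  by_contra hall
  push Not at hall
  have hsub : (Finset.range 10).image (fun i => (X : K[X]) ^ (m + i)) ⊆ Q.roots.toFinset := by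
    intro y hy
    rw [Finset.mem_image] at hy
    obtain ⟨i, hi, rfl⟩ := hy
    rw [Multiset.mem_toFinset, Polynomial.mem_roots hQm.ne_zero]
    exact hall i (Finset.mem_range.1 hi)
  have hcard : ((Finset.range 10).image (fun i => (X : K[X]) ^ (m + i))).card = 10 := by
    rw [Finset.card_image_of_injective _ (fun i j hij => ?_), Finset.card_range]
    have := congrArg Polynomial.natDegree hij
    simp only [Polynomial.natDegree_X_pow] at this
    omega
  have := (Finset.card_le_card hsub).trans
    ((Multiset.toFinset_card_le (m := Q.roots)).trans (Polynomial.card_roots' Q))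
  rw [hcard, hQdeg] at this
  omega

/-- **Semicontinuity of `rank Ω` under degeneration.**  If an integer tensor `S` degenerates to `N`
over the field `K` (`PolyDegeneratesTo`, Alman 2021 §2.4) and `rank Ω_S ≤ r` over every field
receiving `K`, then `rank Ω_N ≤ r`. [cite: Alman2021, §2.4] -/
theorem rank_cayleyForm_le_of_polyDegeneratesTo (S : Fin 3 → Fin 3 → Fin 3 → ℤ)
    {N : Fin 3 → Fin 3 → Fin 3 → K} (hSN : PolyDegeneratesTo (fun a b c => (S a b c : K)) N)
    {r : ℕ} (hS : ∀ (L : Type u) [Field L], (K →+* L) →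
      (cayleyForm (fun a b c => (S a b c : L))).rank ≤ r) :
    (cayleyForm N).rank ≤ r := by
  classical
  obtain ⟨h, A, B, C, hABC⟩ := hSN
  obtain ⟨i, -, hA, hB, hC⟩ := exists_pert_det_ne_zero A B C (h + 1)
  set y : K[X] := X ^ (h + 1 + i) with hy
  set s : Fin 3 → Fin 3 → Fin 3 → K := fun a b c => (S a b c : K) with hs
  set T := polySubst s (pert y A) (pert y B) (pert y C) with hT
  -- the perturbed substitution is still an order-`h` degeneration to `N`
  have hTc : ∀ a b c, ∀ j ≤ h, (T a b c).coeff j = if j = h then N a b c else 0 := by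
    intro a b c j hj
    obtain ⟨q, hq⟩ := polySubst_pert s A B C y a b c
    rw [hT, hq, Polynomial.coeff_add, hy, Polynomial.coeff_X_pow_mul', if_neg (by omega), add_zero]
    exact hABC a b c j hj
  -- `T = εʰ (N + ε T')`
  have hdvd : ∀ a b c, X ^ (h + 1) ∣ T a b c - Polynomial.C (N a b c) * X ^ h := by
    intro a b c
    rw [Polynomial.X_pow_dvd_iff]
    intro d hd
    rw [Polynomial.coeff_sub, Polynomial.coeff_C_mul_X_pow, hTc a b c d (by omega)]
    split_ifs <;> simp
  choose T' hT' using hdvd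
  have hTe : T = (X : K[X]) ^ h • ((fun a b c => Polynomial.C (N a b c)) + (X : K[X]) • T') := by
    funext a b c
    simp only [Pi.smul_apply, Pi.add_apply, smul_eq_mul]
    linear_combination hT' a b c
  have hKF : cayleyForm T = (X : K[X]) ^ h •
      ((cayleyForm N).map (Polynomial.C : K →+* K[X]) + (X : K[X]) • cayleyForm T') := by
    rw [hTe, cayleyForm_smul, cayleyForm_add, cayleyForm_smul, cayleyForm_map]
  have hN : ∀ p q, cayleyForm T p q =
      (Polynomial.C (cayleyForm N p q) + X * cayleyForm T' p q) * X ^ h := by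
    intro p q
    rw [hKF]
    simp only [Matrix.smul_apply, Matrix.add_apply, Matrix.map_apply, smul_eq_mul]
    ring
  -- over the fraction field `L = K(ε)`
  let L := FractionRing K[X]
  have key := rank_le_rank_map_of_perturbation (L := L) (cayleyForm N) (cayleyForm T')
    (cayleyForm T) h hN
  set φ := algebraMap K[X] L with hφ
  have hinj : Function.Injective φ := IsFractionRing.injective K[X] L
  have hmapT : (fun a b c => φ (T a b c)) = tsubst3 (fun a b c => (S a b c : L))
      (fun x a => φ (pert y A x a)) (fun x a => φ (pert y B x a)) (fun x a => φ (pert y C x a)) := by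
    funext a b c
    simp only [hT, polySubst_eq_tsubst3, tsubst3, hs, map_sum, map_mul, map_intCast]
  have hdet' : ∀ {M : Fin 3 → Fin 3 → K[X]}, (Matrix.of M).det ≠ 0 →
      (Matrix.of fun x a => φ (M x a)).det ≠ 0 := by
    intro M hM
    have e : (Matrix.of fun x a => φ (M x a)) = φ.mapMatrix (Matrix.of M) := by
      ext i j; rfl
    rw [e, ← RingHom.map_det]
    exact (map_ne_zero_iff φ hinj).2 hM
  have hbound : ((cayleyForm T).map φ).rank ≤ r := by
    rw [cayleyForm_map, hmapT]
    exact (rank_cayleyForm_tsubst3_le _ _ _ _ (hdet' hA) (hdet' hB) (hdet' hC)).trans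
      (hS L (φ.comp Polynomial.C))
  exact key.trans hbound

end Degeneration

end CayleyOmega

end Summit.MatrixMultiplication.MatrixMultiplication.Theorems
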